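import Summits.CriticalPhenomena.PercolationContinuityZ3.Theorems.Transplant.FKConnectivityAllQAntipodalTwoSpinePhiType
import Summits.CriticalPhenomena.PercolationContinuityZ3.Theorems.Transplant.FKConnectivityAllQAntipodalX2DualRows
import HarnessLib

/-!
# Connectivity correlation inequalities for `φ_{w,q}` — TWO-SPINE word model: `phiRun` PRESERVES THE SIDE WEIGHT (non-critical case)

Helper file (`--supports stmt-CriticalPhenomena-4575`), FK sub-lane `prim-bschramm-fk-2` (gen 15); builds on p205010 (kernel theorem,
internal audit signed; external expert review pending).  No named facts, no sorries, standard axioms.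

Memo `bschramm/FROM-fk-2-g15-TWO-SPINE.md` §12 (V1) / blueprint L2: the word-level shadow of 'Theorem U's injection preserves
`k(γ_side) + k(γᶜ_side)`'.  The SIDE WEIGHT of a word `u` read from a root of type `r` is `corr(α) + corr(ᾱ) + r.1·[headP α] + r.2·[headP ᾱ]`
(the two `corr`s plus the particle adjacencies of the root faces; for the present root `(1,0)` this is `corr + 1 - δ(α)`, for the absent root
`(0,1)` it is `corr + 1 - δ(ᾱ)`, for the deleted root `(0,0)` — Theorem U on `A∖y` — just `corr`).  **`sideWeight_phiRun`**: if the side is of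
type `01` and the run does not reach the root, `phiRun` preserves the side weight.  Proof: peeling the innermost letter changes the weight by a
constant `κ(r, l)` and the root type to `compStep r l` (`sideWeight_cons`); in the flipped case the root is `00` or `11`, so `κ` is symmetric, and
the ground tail is exchanged row for row.
[cite: Grimmett2006, §3.8 (pp. 61–62); §3.9 (p. 63)]
-/

namespace Summit.CriticalPhenomena.PercolationContinuityZ3.Theorems

namespace FK

namespace TwoSpine

open X2Word

/-- SIDE WEIGHT of a word read from a root of type `r`: `corr(α) + corr(ᾱ) + r.1·[headP α] + r.2·[headP ᾱ]`. [folklore] -/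
def sideWeight (r : Bool × Bool) (u : List SLetter) : ℕ :=
  rowCorr (sRowA u) + rowCorr (sRowB u) + (if r.1 && headP (sRowA u) then 1 else 0) + (if r.2 && headP (sRowB u) then 1 else 0)

/-- The weight constant of the innermost letter: a parallel part conducting next to a present root face saves one cluster. [folklore] -/
def kappa (r : Bool × Bool) (l : SLetter) : ℕ :=
  match l.1 with
  | .W => 0
  | .P => (if r.1 && l.2.1 then 1 else 0) + (if r.2 && l.2.2 then 1 else 0)

/-- `corr` of a row with a letter prepended. [folklore] -/
theorem rowCorr_cons (k : Kind) (row : List Kind) :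
    rowCorr (k :: row) = rowCorr row + (if k = .P ∧ headP row = true then 1 else 0) := by
  cases k with
  | W => simp [rowCorr, adjP]
  | P =>
    simp only [rowCorr, adjP, true_and]
    rw [adjP_true_eq]; simp

/-- **Peeling the innermost letter**: `sideWeight r (l :: w) = sideWeight (compStep r l) w + κ(r, l)`. [folklore] -/
theorem sideWeight_cons (r : Bool × Bool) (l : SLetter) (w : List SLetter) :
    sideWeight r (l :: w) = sideWeight (compStep r l) w + kappa r l := by
  obtain ⟨r1, r2⟩ := r
  obtain ⟨k, b, bb⟩ := l
  unfold sideWeight kappa compStep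
  rw [sRowA_cons, sRowB_cons]
  cases k <;> cases b <;> cases bb <;> cases r1 <;> cases r2 <;>
    simp [sVisA, sVisB, rowCorr_cons, headP_cons] <;> split_ifs <;> omega

/-- If the first composite from a non-`01` root is `01` (so the letter is a parallel/series `λ` and the root is `00` or `11`), flipping the
letter does not change `κ`. [folklore] -/
theorem kappa_flip {r : Bool × Bool} {l : SLetter} (hr : is01 r = false) (hc : compStep r l = (false, true)) :
    kappa r (l.1, true, false) = kappa r l := by
  obtain ⟨r1, r2⟩ := r
  obtain ⟨k, b, bb⟩ := l
  cases k <;> cases r1 <;> cases r2 <;> cases b <;> cases bb <;> simp_all [compStep, is01, kappa]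

/-- On a ground word the letterwise `01 → 10` swap is the row exchange `swapLetter`. [folklore] -/
theorem swap01_eq_swapLetter_of_ground {w : List SLetter} (hw : isGround w = true) :
    w.map (fun l => if l.2 == (false, true) then (l.1, true, false) else l) = w.map swapLetter := by
  induction w with
  | nil => rfl
  | cons l w ih =>
    have hl : groundLetter l = true := by simp [isGround] at hw; exact hw.1
    have hw' : isGround w = true := by simp [isGround] at hw ⊢; exact hw.2
    rw [List.map_cons, List.map_cons, ih hw']
    congr 1
    obtain ⟨k, b, bb⟩ := l
    cases k <;> cases b <;> cases bb <;> simp_all [groundLetter, swapLetter]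

/-- The side weight from the present root of the row-exchanged word is the side weight from the absent root. [folklore] -/
theorem sideWeight_present_map_swapLetter (w : List SLetter) :
    sideWeight (true, false) (w.map swapLetter) = sideWeight (false, true) w := by
  simp [sideWeight, sRowA_map_swapLetter, sRowB_map_swapLetter]; omega

/-- **`phiRun` preserves the side weight** when the side is `01` and the run does not reach the root (memo §12 V1: Theorem U's injection is
weight-preserving; so the whole-cell move `Φ_N` of the two-spine rule preserves the cell exponent `e`). [folklore] -/
theorem sideWeight_phiRun {r : Bool × Bool} {w : List SLetter} (h01 : topComp r w = (false, true)) (hnr : phiReachesRoot r w = false) :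
    sideWeight r (phiRun r w) = sideWeight r w := by
  induction w generalizing r with
  | nil =>
    simp only [topComp_nil] at h01
    subst h01
    simp [phiReachesRoot, is01, comps, allAbove] at hnr
  | cons l w ih =>
    rw [phiRun_cons', sideWeight_cons, sideWeight_cons]
    rw [phiReachesRoot_cons] at hnr
    rw [topComp_cons] at h01
    rcases Bool.eq_false_or_eq_true (phiReachesRoot (compStep r l) w) with hreach | hreach
    · have hr : is01 r = false := by simpa [hreach] using hnr
      have hi : is01 (compStep r l) = true := by
        have h := hreach
        simp only [phiReachesRoot, Bool.and_eq_true] at h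
        exact h.1
      have hc01 : compStep r l = (false, true) := eq_of_is01 hi
      obtain ⟨hl, hflip⟩ := compStep_01_of_not01 hr hc01
      have hground : isGround w = true := by rw [← phiReachesRoot_absent_iff]; rwa [hc01] at hreach
      rw [hreach, hl]
      simp only [beq_self_eq_true, Bool.and_self, if_true]
      rw [hflip, hc01, phiRun_absent_ground hground, swap01_eq_swapLetter_of_ground hground, sideWeight_present_map_swapLetter,
        ← hl, kappa_flip hr hc01]
    · rw [hreach]
      simp only [Bool.false_and, Bool.false_eq_true, if_false]
      rw [ih h01 hreach]

end TwoSpine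

end FK

end Summit.CriticalPhenomena.PercolationContinuityZ3.Theorems
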